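import Literature.MathematicalPhysics.QuantumFieldTheory.Balaban1983to89.Node00.MultiScaleFibreChart
import Literature.MathematicalPhysics.QuantumFieldTheory.Balaban1983to89.B16Ineq17NearFlatOneSidedDatum
import Literature.MathematicalPhysics.QuantumFieldTheory.Balaban1983to89.B7BlockAvgLog

/-!
# NODE 00 — THE MULTI-SCALE LOGARITHMIC CHART IS LINEAR ALONG FAMILIES WHOSE CONSTRAINED AVERAGES ARE LEFT TRANSLATES OF THE DATUM:
# `Φ(X) = (π log(W_j(c)* · Ū^j(U·e^X)(c)))_{(j,c)}` and `Ū^j(U·e^{X(g)})(c) = e^{Z(g)_{(j,c)}}·W_j(c)` with `Z` LINEAR ⇒ `Φ(X(g)) = (Ad_{W_j(c)⁻¹} Z(g)_{(j,c)})_{(j,c)}`,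
# so `D²(Φ∘X)(g₀) = 0` — the affine-datum binder `haff` of the near-flat one-sided skeleton of [Balaban1989LargeFieldII] (1.7) HOLDS IDENTICALLY in the chart of record

statement-level skeleton of published theorems with citation tags; proofs where landed; nothing here is a claim about the Yang–Mills mass gap

Cell `pub-ymgap`, HUMAN RULING D-0062 ∕ D-0149, WIDTH SEAT `pub-ymgap-dag-n12-w4` g2 (node N12 = [B15]; U2c lane = the VALUE-level near-flat assembly of [B16] (1.7); key K1⁷
`stmt-QuantumFields-20542`, `--kind proof --supports …`; count-neutral).

WHY THIS FILE.  The near-flat one-sided skeleton (`B16Ineq17NearFlatOneSidedSeminorm.hessian_value_criticalFamily_ge_flatMin_sub_seminorm`, p598593, and its Wilson edition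
`B16Ineq17NearFlatWilsonLetters.hessian_wilsonAction4_criticalExpChartFamily_ge_flatMin_sub`, p599997; consumed at the slice by dag-n12-c's
`B15Prop1SliceHessianOfChartFamily.h17Shape_sliceFn_of_nearFlatCriticalExpChartFamily`, p604041 §4) carries the binder
`haff : λ₀ (D²(Ψ ∘ X_f)(g₀)[h,h]) = 0` — the datum of the family of constrained minimisers is AFFINE in the constraint chart `Ψ`.  A located audit (dag-n12-c, 2026-08-28) asked
whether `haff` is inhabitable when the parameter space is print's slice `B′` and `Ψ` is the chart of record `msChart F N K k 𝐁 W U₀` of `Node00.MultiScaleFibreChart`.  IT IS, and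
identically: the chart's components are `π(log(W_j(c)* · Ū^j(·)(c)))` — logarithmic coordinates RELATIVE to the datum `W` — and along print's family the constrained averages
are LEFT TRANSLATES `e^{Z}·W_j(c)` of the datum with `Z` linear in the slice variable (at level `k` on `Γ_k`: `Z = i·B′(c)`, the section identity `M^k Q_k^{s*} = id`; below `k`,
on the shells `Γ_j`, `Z = 0`: the shells do not see the slice's `k`-blocks).  Conjugation by the unitary `W_j(c)` commutes with `exp` and with the logarithmic series, so the
component is `π(log(e^{Ad_{W_j(c)⁻¹}Z})) = Ad_{W_j(c)⁻¹} Z` for `‖Z‖ < ln 2` (`B7BlockAvgLog.mlog_exp`): the chart is a LINEAR function of `Z`, hence of the slice variable, near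
the base; its second derivative vanishes (`B16Ineq17NearFlatOneSidedDatum.fderiv_fderiv_datum_eq_zero_of_eventually_affine`, p596092) and its first derivative is the
`Ad`-twisted embedding `h ↦ (Ad_{W_j(c)⁻¹}(Z h)_{(j,c)})` — the datum velocity `y` of the Federbush fibre letter `hm`∕`hy` (`Summit…N12NearFlatFederbushFibreChart`, p603788; the twist is undone on
`circ` by `B16Ineq17SliceTwist.circ_twist_ge_sub`, p605427).  What remains DISPLAYED for a consumer is the family-on-fibre letter
`havg : ∀ᶠ g, ∀ (j,c) ∈ 𝐁, Ū^j(U₀·e^{X_f g})(c) = e^{Z(g − g₀)_{(j,c)}}·W_j(c)` (print: the minimiser `U_{k,Z}(V_k)` of (1.74) satisfies its constraints, [Balaban1989LargeFieldI]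
(1.74) p. 192, with `V_k = exp(iB′)·Ṽ_k`, [Balaban1989LargeFieldII] p. 359).

CONTENTS (namespace `…Balaban1983to89.Node00`).
* §1 `coe_inv_SU_eq_star`, `coe_specialUnitaryAd_inv`, `star_coe_mul_exp_mul_coe_eq_exp` (`W*·e^Z·W = e^{Ad_{W⁻¹}Z}`), `norm_coe_specialUnitaryAd_inv`,
  ★ `suProj_mlog_star_coe_mul_exp_mul_coe` (`‖Z‖ < ln 2 ⇒ π log(W*·e^Z·W) = Ad_{W⁻¹} Z`).
* §2 ★★ `msChart_eq_ad_of_avg_eq` (pointwise: constrained averages `e^{Z_{(j,c)}}·W_j(c)`, `‖Z‖ < ln 2` ⇒ the chart is `(Ad_{W_j(c)⁻¹} Z_{(j,c)})_{(j,c)}` — linear in `Z`).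
* §3 families (`Z : G →L[ℝ] (ConstrSet 𝐁 k → 𝔰𝔲(N))`, hypothesis `havg` eventual near `g₀`): `eventually_norm_coe_apply_lt_log_two`, `pi_ad_comp_apply`,
  ★★ `eventually_msChart_family_eq_affine`, ★★★ `fderiv_fderiv_msChart_family_eq_zero` (`D²(msChart ∘ X_f)(g₀)[h,h′] = 0`),
  ★★★ `haff_msChart_of_avg_family` (the skeleton's binder verbatim: `λ₀ (…) = 0` for EVERY `λ₀`), ★★ `hasFDerivAt_msChart_family` ∕ `fderiv_msChart_family_apply`
  (`D(msChart ∘ X_f)(g₀) h = (Ad_{W_j(c)⁻¹}(Z h)_{(j,c)})`), ★★ `fderiv_msChart_comp_apply_eq_ad` (with `X_f` differentiable at `g₀` and the chart differentiable at `X_f g₀`: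
  `DΨ(X_f g₀)(X_f′ h) = (Ad_{W_j(c)⁻¹}(Z h)_{(j,c)})` — the `y` of `hy`).  (No `def`: the twisted embedding is written out as `ContinuousLinearMap.pi …` where a map is needed.)

Nothing of Bałaban's is asserted; count-neutral; N12 NOT discharged; the YM mass gap (Clay) is NOT proved by any of this.
-/

noncomputable section

namespace Literature.MathematicalPhysics.QuantumFieldTheory.Balaban1983to89.Node00

open Filter Topology
open T4Continuum (T4Family)
open B15DeterminingSets
open MatrixLog (mlog)
open T4AdjointCovarianceUnitary (lieSU expSU coe_expSU specialUnitaryAd coe_specialUnitaryAd expSU_specialUnitaryAd)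
open scoped Matrix.Norms.L2Operator

/-! ## §1  Conjugation by the datum commutes with `exp` and `log` -/

section Lie

variable {N : ℕ}

/-- The inverse in `SU(N)` is the adjoint on underlying matrices. [cite: Balaban1985Averaging, (17) p.21 (bookkeeping)] -/
theorem coe_inv_SU_eq_star (W : SU N) : ((W⁻¹ : SU N) : Matrix (Fin N) (Fin N) ℂ) = star (W : Matrix (Fin N) (Fin N) ℂ) := rfl

/-- `Ad_{W⁻¹} Z = W*·Z·W` on underlying matrices. [cite: Balaban1985Averaging, (17) p.21; Balaban1988Convergent, (1.17) p.250] -/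
theorem coe_specialUnitaryAd_inv (W : SU N) (Z : lieSU (Fin N)) :
    ((specialUnitaryAd W⁻¹ Z : lieSU (Fin N)) : Matrix (Fin N) (Fin N) ℂ) = star (W : Matrix (Fin N) (Fin N) ℂ) * Z * W := by
  rw [coe_specialUnitaryAd]
  show star (W : Matrix (Fin N) (Fin N) ℂ) * Z * star (star (W : Matrix (Fin N) (Fin N) ℂ)) = _
  rw [star_star]

/-- **CONJUGATION COMMUTES WITH THE EXPONENTIAL**: `W*·e^Z·W = e^{Ad_{W⁻¹}Z}` (`T4AdjointCovarianceUnitary.expSU_specialUnitaryAd` read on matrices).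
[cite: Balaban1985BackgroundPropagators, (3.29) p.395; Balaban1985Averaging, (17) p.21] -/
theorem star_coe_mul_exp_mul_coe_eq_exp (W : SU N) (Z : lieSU (Fin N)) :
    star (W : Matrix (Fin N) (Fin N) ℂ) * NormedSpace.exp (Z : Matrix (Fin N) (Fin N) ℂ) * W
      = NormedSpace.exp (((specialUnitaryAd W⁻¹ Z : lieSU (Fin N)) : Matrix (Fin N) (Fin N) ℂ)) := by
  have h := congrArg (fun g : SU N => (g : Matrix (Fin N) (Fin N) ℂ)) (expSU_specialUnitaryAd W⁻¹ Z)
  simp only [coe_expSU, inv_inv] at h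
  rw [h]
  rfl

/-- `‖Ad_{W⁻¹} Z‖ = ‖Z‖` in the operator norm (19) (the norm is a C⋆-norm and `W` is unitary). [cite: Balaban1985Averaging, (17)–(19) p.21] -/
theorem norm_coe_specialUnitaryAd_inv (W : SU N) (Z : lieSU (Fin N)) :
    ‖((specialUnitaryAd W⁻¹ Z : lieSU (Fin N)) : Matrix (Fin N) (Fin N) ℂ)‖ = ‖(Z : Matrix (Fin N) (Fin N) ℂ)‖ := by
  rw [coe_specialUnitaryAd, CStarRing.norm_mul_mem_unitary _ (Unitary.star_mem (W⁻¹).2.1), CStarRing.norm_mem_unitary_mul _ (W⁻¹).2.1]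

/-- ★ **THE RELATIVE LOGARITHMIC COORDINATE OF A LEFT TRANSLATE IS THE TWISTED LIE ELEMENT**: for `Z ∈ 𝔰𝔲(N)` with `‖Z‖ < ln 2` (operator norm) and `W ∈ SU(N)`,
`π(log(W*·e^Z·W)) = Ad_{W⁻¹} Z` — `log e^C = C` for `‖C‖ < ln 2` (`B7BlockAvgLog.mlog_exp`, the series (21) of [Balaban1985Averaging]) at `C = Ad_{W⁻¹}Z`, and `π` is the
identity on `𝔰𝔲(N)`.  This is why print's LINEARIZING TRANSFORMATION (Sect. C of [Balaban1985Variational]) is linear along left translates of the datum.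
[cite: Balaban1985Variational, Sect. C (47)–(48) p.285, (82)–(83) p.290; Balaban1985Averaging, (21)–(26) pp.21–22] -/
theorem suProj_mlog_star_coe_mul_exp_mul_coe (W : SU N) {Z : lieSU (Fin N)} (hZ : ‖(Z : Matrix (Fin N) (Fin N) ℂ)‖ < Real.log 2) :
    suProj N (mlog (star (W : Matrix (Fin N) (Fin N) ℂ) * NormedSpace.exp (Z : Matrix (Fin N) (Fin N) ℂ) * W)) = specialUnitaryAd W⁻¹ Z := by
  rw [star_coe_mul_exp_mul_coe_eq_exp, B7BlockAvgLog.mlog_exp (by rw [norm_coe_specialUnitaryAd_inv]; exact hZ), suProj_coe]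

end Lie

/-! ## §2  Pointwise: the chart is the twisted Lie family wherever the constrained averages are left translates of the datum -/

section Twist

variable {F : T4Family} {N : ℕ} [NeZero N]
variable {K k : ℕ} {𝔹 : DetSet (F.P K)} {W : MSField (F.P K) (SU N)} {U : GaugeField (F.P K) 0 (SU N)}

/-- ★★ **THE CHART IS THE TWISTED LIE FAMILY WHEREVER THE CONSTRAINED AVERAGES ARE LEFT TRANSLATES OF THE DATUM**: if at the chart point `X` every constrained average is
`Ū^j(U·e^X)(c) = e^{Z_{(j,c)}}·W_j(c)` with `‖Z_{(j,c)}‖ < ln 2`, then the `(j,c)`-component of `msChart F N K k 𝐁 W U X` is `Ad_{W_j(c)⁻¹} Z_{(j,c)}` (the TWISTED EMBEDDING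
`Z ↦ (Ad_{W_j(c)⁻¹} Z_{(j,c)})_{(j,c)}`, re-indexed by the chart's enumeration — linear in `Z`).
[cite: Balaban1985Variational, Sect. C (47)–(48) p.285, (82)–(83) p.290; Balaban1988Convergent, (2.10)–(2.12) p.256] -/
theorem msChart_eq_ad_of_avg_eq {X : PBond (F.P K) 0 → lieSU (Fin N)} {Z : ConstrSet 𝔹 k → lieSU (Fin N)}
    (hZ : ∀ s, ‖(Z s : Matrix (Fin N) (Fin N) ℂ)‖ < Real.log 2)
    (havg : ∀ s : ConstrSet 𝔹 k, avgFamily (avOfRecord F N K) (expChart U X) s.1 s.2.1 = expSU (Z s) * W s.1 s.2.1) :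
    msChart F N K k 𝔹 W U X = fun i =>
      specialUnitaryAd (W ((constrEnum 𝔹 k).symm i).1 ((constrEnum 𝔹 k).symm i).2.1)⁻¹ (Z ((constrEnum 𝔹 k).symm i)) := by
  funext i
  rw [msChart_apply, relAvg, havg, Submonoid.coe_mul, coe_expSU, ← mul_assoc]
  exact suProj_mlog_star_coe_mul_exp_mul_coe _ (hZ _)

end Twist

/-! ## §3  Along a family: the chart is eventually linear, its second derivative vanishes, its first derivative is the twisted embedding -/

section Family

variable {F : T4Family} {N : ℕ} [NeZero N]
variable {K k : ℕ} {𝔹 : DetSet (F.P K)} {W : MSField (F.P K) (SU N)} {U : GaugeField (F.P K) 0 (SU N)}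
variable {G : Type*} [NormedAddCommGroup G] [NormedSpace ℝ G]

omit [NeZero N] in
/-- A linear family of Lie elements is eventually inside the radius `ln 2` of `log ∘ exp = id`. [cite: Balaban1985Averaging, (21)–(26) pp.21–22 (bookkeeping)] -/
theorem eventually_norm_coe_apply_lt_log_two (Zf : G →L[ℝ] (ConstrSet 𝔹 k → lieSU (Fin N))) (g₀ : G) :
    ∀ᶠ g in 𝓝 g₀, ∀ s, ‖((Zf (g - g₀) s : lieSU (Fin N)) : Matrix (Fin N) (Fin N) ℂ)‖ < Real.log 2 := by
  refine eventually_all.2 fun s => ?_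
  have hc : Continuous fun g : G => ‖((Zf (g - g₀) s : lieSU (Fin N)) : Matrix (Fin N) (Fin N) ℂ)‖ :=
    ((continuous_subtype_val.comp ((continuous_apply s).comp (Zf.continuous.comp (continuous_id.sub continuous_const)))).norm)
  have h0 : ‖((Zf (g₀ - g₀) s : lieSU (Fin N)) : Matrix (Fin N) (Fin N) ℂ)‖ < Real.log 2 := by
    rw [sub_self, map_zero, Pi.zero_apply, ZeroMemClass.coe_zero, norm_zero]
    exact Real.log_pos one_lt_two
  exact hc.continuousAt.eventually_lt_const h0

omit [NeZero N] in
/-- The twisted embedding composed with a linear Lie family, as ONE continuous linear map `G → (Fin #𝐁 → 𝔰𝔲(N))`, evaluated: its `i`-th component at `h` is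
`Ad_{W_j(c)⁻¹} (Z h)_{(j,c)}`, `(j,c)` the `i`-th constrained bond. [cite: Balaban1985Variational, (82)–(83) p.290 (bookkeeping)] -/
theorem pi_ad_comp_apply (Zf : G →L[ℝ] (ConstrSet 𝔹 k → lieSU (Fin N))) (h : G) (i : Fin (constrCard 𝔹 k)) :
    (ContinuousLinearMap.pi fun i : Fin (constrCard 𝔹 k) =>
        (specialUnitaryAd (W ((constrEnum 𝔹 k).symm i).1 ((constrEnum 𝔹 k).symm i).2.1)⁻¹).toContinuousLinearEquiv.toContinuousLinearMap.comp
          ((ContinuousLinearMap.proj ((constrEnum 𝔹 k).symm i)).comp Zf)) h i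
      = specialUnitaryAd (W ((constrEnum 𝔹 k).symm i).1 ((constrEnum 𝔹 k).symm i).2.1)⁻¹ (Zf h ((constrEnum 𝔹 k).symm i)) := rfl

/-- ★★ **ALONG A FAMILY WHOSE CONSTRAINED AVERAGES ARE LEFT TRANSLATES BY A LINEAR LIE FAMILY, THE CHART IS EVENTUALLY LINEAR**:
`(∀ᶠ g, ∀ (j,c), Ū^j(U·e^{X_f g})(c) = e^{Z(g − g₀)_{(j,c)}}·W_j(c))` ⇒ `∀ᶠ g, msChart … (X_f g) = 0 + ℓ(g − g₀)` with `ℓ` the twisted embedding composed with `Z` (the affine shape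
of `B16Ineq17NearFlatOneSidedDatum.fderiv_fderiv_datum_eq_zero_of_eventually_affine`, `v₀ = 0`). [cite: Balaban1985Variational, Sect. C (47)–(48) p.285, (82)–(83) p.290; Balaban1989LargeFieldII, (1.7) p.358, p.359] -/
theorem eventually_msChart_family_eq_affine {Xf : G → PBond (F.P K) 0 → lieSU (Fin N)} {g₀ : G} (Zf : G →L[ℝ] (ConstrSet 𝔹 k → lieSU (Fin N)))
    (havg : ∀ᶠ g in 𝓝 g₀, ∀ s : ConstrSet 𝔹 k, avgFamily (avOfRecord F N K) (expChart U (Xf g)) s.1 s.2.1 = expSU (Zf (g - g₀) s) * W s.1 s.2.1) :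
    ∀ᶠ g in 𝓝 g₀, msChart F N K k 𝔹 W U (Xf g) = 0 +
      (ContinuousLinearMap.pi fun i : Fin (constrCard 𝔹 k) =>
        (specialUnitaryAd (W ((constrEnum 𝔹 k).symm i).1 ((constrEnum 𝔹 k).symm i).2.1)⁻¹).toContinuousLinearEquiv.toContinuousLinearMap.comp
          ((ContinuousLinearMap.proj ((constrEnum 𝔹 k).symm i)).comp Zf)) (g - g₀) := by
  filter_upwards [havg, eventually_norm_coe_apply_lt_log_two Zf g₀] with g hg hZ
  rw [zero_add, msChart_eq_ad_of_avg_eq hZ hg]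
  rfl

/-- ★★★ **THE SECOND DERIVATIVE OF THE CHART ALONG SUCH A FAMILY VANISHES**: `D²(msChart ∘ X_f)(g₀)[h,h′] = 0`.
[cite: Balaban1989LargeFieldII, (1.7) p.358, (1.12)–(1.13) p.359; Balaban1985Variational, (82)–(83) p.290, (174)–(177) pp.305–306] -/
theorem fderiv_fderiv_msChart_family_eq_zero {Xf : G → PBond (F.P K) 0 → lieSU (Fin N)} {g₀ : G} (Zf : G →L[ℝ] (ConstrSet 𝔹 k → lieSU (Fin N)))
    (havg : ∀ᶠ g in 𝓝 g₀, ∀ s : ConstrSet 𝔹 k, avgFamily (avOfRecord F N K) (expChart U (Xf g)) s.1 s.2.1 = expSU (Zf (g - g₀) s) * W s.1 s.2.1)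
    (h h' : G) :
    fderiv ℝ (fun g => fderiv ℝ (fun g => msChart F N K k 𝔹 W U (Xf g)) g) g₀ h h' = 0 :=
  B16Ineq17NearFlatOneSidedDatum.fderiv_fderiv_datum_eq_zero_of_eventually_affine _ (eventually_msChart_family_eq_affine Zf havg) h h'

/-- ★★★ **THE SKELETON'S AFFINE-DATUM BINDER `haff` HOLDS IDENTICALLY IN THE CHART OF RECORD**: for EVERY functional `λ₀` and all directions,
`λ₀ (D²(msChart ∘ X_f)(g₀)[h,h′]) = 0` — the hypothesis `haff` of `B16Ineq17NearFlatOneSidedSeminorm.hessian_value_criticalFamily_ge_flatMin_sub_seminorm` ∕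
`B16Ineq17NearFlatWilsonLetters.hessian_wilsonAction4_criticalExpChartFamily_ge_flatMin_sub` ∕ `B15Prop1SliceHessianOfChartFamily.h17Shape_sliceFn_of_nearFlatCriticalExpChartFamily`
at `Ψ := msChart F N K k 𝐁 W U₀`, discharged from the family-on-fibre letter `havg` alone (no curvature term, no extra error letter).
[cite: Balaban1989LargeFieldII, (1.7) p.358, (1.12)–(1.13) p.359; Balaban1985Variational, Sect. C (47)–(48) p.285, (82)–(83) p.290] -/
theorem haff_msChart_of_avg_family {Xf : G → PBond (F.P K) 0 → lieSU (Fin N)} {g₀ : G} (Zf : G →L[ℝ] (ConstrSet 𝔹 k → lieSU (Fin N)))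
    (havg : ∀ᶠ g in 𝓝 g₀, ∀ s : ConstrSet 𝔹 k, avgFamily (avOfRecord F N K) (expChart U (Xf g)) s.1 s.2.1 = expSU (Zf (g - g₀) s) * W s.1 s.2.1)
    (lam : (Fin (constrCard 𝔹 k) → lieSU (Fin N)) →L[ℝ] ℝ) (h h' : G) :
    lam (fderiv ℝ (fun g => fderiv ℝ (fun g => msChart F N K k 𝔹 W U (Xf g)) g) g₀ h h') = 0 := by
  rw [fderiv_fderiv_msChart_family_eq_zero Zf havg, map_zero]

/-- ★★ **THE FIRST DERIVATIVE OF THE CHART ALONG THE FAMILY IS THE TWISTED EMBEDDING**: `HasFDerivAt (msChart ∘ X_f) ℓ g₀`, `ℓ h = (Ad_{W_j(c)⁻¹}(Z h)_{(j,c)})_{(j,c)}`.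
[cite: Balaban1985Variational, (82)–(83) p.290; Balaban1989LargeFieldII, p.359] -/
theorem hasFDerivAt_msChart_family {Xf : G → PBond (F.P K) 0 → lieSU (Fin N)} {g₀ : G} (Zf : G →L[ℝ] (ConstrSet 𝔹 k → lieSU (Fin N)))
    (havg : ∀ᶠ g in 𝓝 g₀, ∀ s : ConstrSet 𝔹 k, avgFamily (avOfRecord F N K) (expChart U (Xf g)) s.1 s.2.1 = expSU (Zf (g - g₀) s) * W s.1 s.2.1) :
    HasFDerivAt (fun g => msChart F N K k 𝔹 W U (Xf g))
      (ContinuousLinearMap.pi fun i : Fin (constrCard 𝔹 k) =>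
        (specialUnitaryAd (W ((constrEnum 𝔹 k).symm i).1 ((constrEnum 𝔹 k).symm i).2.1)⁻¹).toContinuousLinearEquiv.toContinuousLinearMap.comp
          ((ContinuousLinearMap.proj ((constrEnum 𝔹 k).symm i)).comp Zf)) g₀ := by
  set ℓ : G →L[ℝ] (Fin (constrCard 𝔹 k) → lieSU (Fin N)) := ContinuousLinearMap.pi fun i : Fin (constrCard 𝔹 k) =>
    (specialUnitaryAd (W ((constrEnum 𝔹 k).symm i).1 ((constrEnum 𝔹 k).symm i).2.1)⁻¹).toContinuousLinearEquiv.toContinuousLinearMap.comp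
      ((ContinuousLinearMap.proj ((constrEnum 𝔹 k).symm i)).comp Zf) with hℓ
  have hev := eventually_msChart_family_eq_affine (U := U) (W := W) Zf havg
  have hlin : HasFDerivAt (fun g : G => (0 : Fin (constrCard 𝔹 k) → lieSU (Fin N)) + ℓ (g - g₀)) ℓ g₀ := by
    have h1 : HasFDerivAt (fun g : G => ℓ (g - g₀)) (ℓ.comp (ContinuousLinearMap.id ℝ G)) g₀ :=
      ℓ.hasFDerivAt.comp g₀ ((hasFDerivAt_id g₀).sub_const g₀)
    rw [ContinuousLinearMap.comp_id] at h1
    exact h1.const_add _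
  exact hlin.congr_of_eventuallyEq hev

/-- `fderiv` form of `hasFDerivAt_msChart_family`, evaluated: `D(msChart ∘ X_f)(g₀) h = (Ad_{W_j(c)⁻¹}(Z h)_{(j,c)})_{(j,c)}`. [cite: Balaban1985Variational, (82)–(83) p.290; Balaban1989LargeFieldII, p.359] -/
theorem fderiv_msChart_family_apply {Xf : G → PBond (F.P K) 0 → lieSU (Fin N)} {g₀ : G} (Zf : G →L[ℝ] (ConstrSet 𝔹 k → lieSU (Fin N)))
    (havg : ∀ᶠ g in 𝓝 g₀, ∀ s : ConstrSet 𝔹 k, avgFamily (avOfRecord F N K) (expChart U (Xf g)) s.1 s.2.1 = expSU (Zf (g - g₀) s) * W s.1 s.2.1) (h : G) :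
    fderiv ℝ (fun g => msChart F N K k 𝔹 W U (Xf g)) g₀ h = fun i =>
      specialUnitaryAd (W ((constrEnum 𝔹 k).symm i).1 ((constrEnum 𝔹 k).symm i).2.1)⁻¹ (Zf h ((constrEnum 𝔹 k).symm i)) := by
  rw [(hasFDerivAt_msChart_family Zf havg).fderiv]
  rfl

/-- ★★ **THE DATUM VELOCITY OF THE FAMILY IS THE TWISTED LIE ELEMENT** (the `y` of the Federbush fibre letter `hm`∕`hy`): if moreover `X_f` is differentiable at `g₀` with
derivative `X_f′` and the chart is differentiable at `X_f g₀`, then `D(msChart)(X_f g₀)(X_f′ h) = (Ad_{W_j(c)⁻¹}(Z h)_{(j,c)})_{(j,c)}` for every direction `h` (chain rule +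
uniqueness of the derivative). [cite: Balaban1985Variational, (82)–(83) p.290; Balaban1989LargeFieldII, (1.12) p.359] -/
theorem fderiv_msChart_comp_apply_eq_ad {Xf : G → PBond (F.P K) 0 → lieSU (Fin N)} {g₀ : G} (Zf : G →L[ℝ] (ConstrSet 𝔹 k → lieSU (Fin N)))
    (havg : ∀ᶠ g in 𝓝 g₀, ∀ s : ConstrSet 𝔹 k, avgFamily (avOfRecord F N K) (expChart U (Xf g)) s.1 s.2.1 = expSU (Zf (g - g₀) s) * W s.1 s.2.1)
    {X' : G →L[ℝ] PBond (F.P K) 0 → lieSU (Fin N)} (hX : HasFDerivAt Xf X' g₀)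
    (hΨ : DifferentiableAt ℝ (msChart F N K k 𝔹 W U) (Xf g₀)) (h : G) :
    fderiv ℝ (msChart F N K k 𝔹 W U) (Xf g₀) (X' h) = fun i =>
      specialUnitaryAd (W ((constrEnum 𝔹 k).symm i).1 ((constrEnum 𝔹 k).symm i).2.1)⁻¹ (Zf h ((constrEnum 𝔹 k).symm i)) := by
  have hcomp : HasFDerivAt (fun g => msChart F N K k 𝔹 W U (Xf g)) ((fderiv ℝ (msChart F N K k 𝔹 W U) (Xf g₀)).comp X') g₀ :=
    hΨ.hasFDerivAt.comp g₀ hX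
  rw [← fderiv_msChart_family_apply Zf havg h, hcomp.fderiv, ContinuousLinearMap.comp_apply]

end Family

end Literature.MathematicalPhysics.QuantumFieldTheory.Balaban1983to89.Node00

end
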